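/-
Copyright (c) 2026. All rights reserved.
Released under Apache 2.0 license as described in the file LICENSE.
Authors: abc-iut cell, wave-3 discharge seat abc-iut-L6-d5 (proof-only).
-/
import Mathlib.MeasureTheory.Constructions.BorelSpace.Metric
import Mathlib.Topology.MetricSpace.Thickening
import Literature.IUT.LogThetaLattice.RealifiedSemisimplification
import Literature.AnabelianGeometry.AbsoluteAnabelian.LocalVolumesNonarchimedeanProofs
import Literature.AnabelianGeometry.AbsoluteAnabelian.LogIsometricUnitLog
import Literature.IUT.LogVolume.UnitLogFibres
import Literature.IUT.LogVolume.LogShellTopology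
import HarnessLib

/-!
# [IUTchIII] Remark 3.9.4 (iii): the named fact `Remark394iii_logPreservesVolume` DISCHARGED at the
# real objects (the `p`-adic logarithm on `𝒪_k^×` and an additive Haar measure of `k`)

S. Mochizuki, *Inter-universal Teichmüller theory III*, kurims manuscript (May 2020), §3, Remark 3.9.4
(iii), p. 122 l. 62 ff.: for `k` a finite extension of `ℚ_p`, "`𝒪^×_k ⊆ k` is an ample subset; for any
compact ample subset `S ⊆ 𝒪^×_k` on which `log_k : 𝒪^×_k → k` is injective, we have
`μ_k(S) = μ_k(log_k(S))` [cf. [AbsTopIII], Proposition 5.7, (i), (c)]" — the measure-theoretic input of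
the log-link compatibility of log-volumes at `v ∈ 𝕍^non` ([IUTchIII] Prop. 3.9 (iv)).

PROOF-ONLY companion of abc-iut-L6-t4's `Literature/IUT/LogThetaLattice/RealifiedSemisimplification.lean`
(p404272), which typed this sentence as the named `Prop`
`Remark394iii_logPreservesVolume U logk vol` over abstract data `(U, logk, vol)` (TODO-merge
abc-iut-L4-t3). Here it is PROVED (node **IUTchIII:Rmk3.9.4(iii)**) for

* `k := K` any mixed-characteristic nonarchimedean local field in the cell's norm-side presentation
  (`[NormedAlgebra ℚ_[p] K] [IsUltrametricDist K] [ProperSpace K]`),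
* `U := 𝒪_K^× = {‖x‖ = 1}`, `logk := Literature.IUT.LogVolume.unitLog` (abc-iut-S1's `p`-adic logarithm,
  `LocalUnitLog.lean`),
* `vol := μ` ANY additive Haar measure on `K` (in particular abc-iut-L4-t3's normalised `localHaar K`):

`remark394iii_logPreservesVolume_unitLog`. The point beyond the tree: abc-iut-L4-t3/t8's
`LogVolumeCompatibleOfIsometric_holds` + abc-iut-L3-t11's `isIsometricOnSmallBalls_unitLog` give
[AbsTopIII] Prop. 5.7 (i)(c) for compact OPEN `A ⊆ 𝒪_K^×`; Remark 3.9.4 (iii) quantifies over compact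
AMPLE (= compact, positive measure) subsets, which need not be open. The reduction (classical):

1. `log_p` is injective on every closed ball of radius `p⁻²` centred at a unit (its fibres are torsion
   cosets, `unitLog_eq_iff`, and a root of unity that close to `1` is `1`);
2. hence a compact `S ⊆ 𝒪_K^×` on which `log_p` is injective has a closed `ρ`-thickening
   `S_ρ = ⋃_{s ∈ S} closedBall s ρ` on which `log_p` is still injective (minimum of
   `‖log_p s − log_p t‖` over the compact set of pairs at distance `≥ p⁻²`);
3. for small `ρ`, `log_p(S_ρ) = (log_p S)_ρ` (`log_p` maps small closed balls at units ONTO closed balls,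
   `isIsometricOnSmallBalls_unitLog`), and both thickenings are compact open, so Prop. 5.7 (i)(c) gives
   `μ(S_ρ) = μ((log_p S)_ρ)`;
4. `ρ → 0`: `μ(S_ρ) → μ(S)` and `μ((log_p S)_ρ) → μ(log_p S)` (`tendsto_measure_cthickening_of_isCompact`);
5. any additive Haar measure is a scalar multiple of `localHaar K` (`addHaarMeasure_unique`).

No definitions; nothing here takes a side on [IUTchIII] Cor. 3.12 (Remark 3.9.4 (iii) is classical
`p`-adic measure theory; the tag records that the STATEMENT is transcribed from [IUTchIII]).
-/

set_option autoImplicit false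

noncomputable section

open MeasureTheory MeasureTheory.Measure Set Metric Filter
open scoped NNReal ENNReal Topology

namespace Literature.IUT.LogThetaLattice

open Literature.IUT.LogVolume Literature.AnabelianGeometry.AbsoluteAnabelian

/-! ## 0. Two elementary facts -/

section Elementary

variable {K : Type*} [NontriviallyNormedField K] [IsUltrametricDist K]

/-- A point at distance `< 1` from a unit is a unit. [cite: Mochizuki2012, III Rmk 3.9.4 (iii) p.122] -/
theorem norm_eq_one_of_mem_closedBall_unit {x y : K} (hx : ‖x‖ = 1) {r : ℝ} (hr : r < 1)
    (hy : y ∈ closedBall x r) : ‖y‖ = 1 := by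
  have hx0 : x ≠ 0 := norm_pos_iff.mp (by rw [hx]; exact one_pos)
  have h1 : ‖1 - x⁻¹ * y‖ ≤ r := (mem_closedBall_unit_iff hx r y).mp hy
  have hP : IsPrincipal (x⁻¹ * y) := h1.trans_lt hr
  have hy' : y = x * (x⁻¹ * y) := by rw [← mul_assoc, mul_inv_cancel₀ hx0, one_mul]
  rw [hy', norm_mul, hx, hP.norm_eq_one, one_mul]

variable (p : ℕ) [Fact p.Prime]

/-- `p⁻² < 1`. [cite: Mochizuki2012, III Rmk 3.9.4 (iii) p.122] -/
theorem rpow_neg_two_lt_one : (p : ℝ) ^ (-(2 : ℝ)) < 1 :=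
  Real.rpow_lt_one_of_one_lt_of_neg (by exact_mod_cast (Fact.out : p.Prime).one_lt) (by norm_num)

/-- `0 < p⁻²`. [cite: Mochizuki2012, III Rmk 3.9.4 (iii) p.122] -/
theorem rpow_neg_two_pos : (0 : ℝ) < (p : ℝ) ^ (-(2 : ℝ)) :=
  Real.rpow_pos_of_pos (by exact_mod_cast (Fact.out : p.Prime).pos) _

end Elementary

variable (p : ℕ) [Fact p.Prime]
variable (K : Type*) [NontriviallyNormedField K] [instK : NormedAlgebra ℚ_[p] K] [IsUltrametricDist K]
  [ProperSpace K]

include instK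

/-! ## 1. Local injectivity of `log_p` at radius `p⁻²` -/

/-- **`log_p` is injective on every closed ball of radius `p⁻²` centred at a unit**: if
`log_p u = log_p v` then `u = ζ v` with `ζ` a root of unity (`unitLog_eq_iff`), and `‖1 − ζ‖ ≤ p⁻²`
forces `ζ = 1`. [cite: Mochizuki2012, III Rmk 3.9.4 (iii) p.122] -/
theorem unitLog_injOn_closedBall_unit {x : K} (hx : ‖x‖ = 1) :
    InjOn (unitLog (K := K)) (closedBall x ((p : ℝ) ^ (-(2 : ℝ)))) := by
  have hρ1 : (p : ℝ) ^ (-(2 : ℝ)) < 1 := rpow_neg_two_lt_one p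
  intro u hu v hv h
  have hu1 : ‖u‖ = 1 := norm_eq_one_of_mem_closedBall_unit hx hρ1 hu
  have hv1 : ‖v‖ = 1 := norm_eq_one_of_mem_closedBall_unit hx hρ1 hv
  obtain ⟨ζ, hζ, rfl⟩ := (unitLog_eq_iff p K hu1 hv1).mp h
  have hv0 : v ≠ 0 := norm_pos_iff.mp (by rw [hv1]; exact one_pos)
  -- `‖1 - ζ‖ = ‖ζ v - v‖ ≤ p⁻²`
  have hdist : ‖ζ * v - v‖ ≤ (p : ℝ) ^ (-(2 : ℝ)) := by
    have h3 := dist_triangle_max (ζ * v) x v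
    rw [dist_comm x v] at h3
    rw [← dist_eq_norm]
    exact h3.trans (max_le hu hv)
  have h1ζ : ‖1 - ζ‖ ≤ (p : ℝ) ^ (-(2 : ℝ)) := by
    have h3 : (1 : K) - ζ = -((ζ * v - v) * v⁻¹) := by
      rw [sub_mul, mul_inv_cancel_right₀ hv0, mul_inv_cancel₀ hv0, neg_sub]
    rw [h3, norm_neg, norm_mul, norm_inv, hv1, inv_one, mul_one]
    exact hdist
  have hζ1 : ζ = 1 :=
    IsTorsionUnit.eq_one_of_norm_one_sub_le p K (rpow_neg_two_mul_lt_one p) hζ h1ζ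
  rw [hζ1, one_mul]

/-! ## 2. Injectivity on a closed thickening of a compact set -/

/-- A uniform gap: if `log_p` is injective on a compact `S ⊆ 𝒪_K^×`, then `‖log_p s − log_p t‖` is
bounded below by some `m > 0` on the pairs `s, t ∈ S` at distance `≥ p⁻²`.
[cite: Mochizuki2012, III Rmk 3.9.4 (iii) p.122] -/
theorem exists_gap_of_injOn {S : Set K} (hSU : S ⊆ {x : K | ‖x‖ = 1}) (hS : IsCompact S)
    (hinj : InjOn (unitLog (K := K)) S) :
    ∃ m : ℝ, 0 < m ∧ ∀ s ∈ S, ∀ t ∈ S, (p : ℝ) ^ (-(2 : ℝ)) ≤ ‖s - t‖ →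
      m ≤ ‖unitLog s - unitLog t‖ := by
  -- the compact set `D` of "far" pairs
  have hDc : IsCompact {z : K × K | z ∈ S ×ˢ S ∧ (p : ℝ) ^ (-(2 : ℝ)) ≤ ‖z.1 - z.2‖} :=
    (hS.prod hS).inter_right (isClosed_le continuous_const (continuous_fst.sub continuous_snd).norm)
  -- the gap function is continuous on `D`
  have hcont : ContinuousOn (fun z : K × K => ‖unitLog z.1 - unitLog z.2‖)
      {z : K × K | z ∈ S ×ˢ S ∧ (p : ℝ) ^ (-(2 : ℝ)) ≤ ‖z.1 - z.2‖} := by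
    have h1 : ContinuousOn (fun z : K × K => unitLog z.1) (S ×ˢ S) :=
      (continuousOn_unitLog p K).comp continuous_fst.continuousOn
        (fun z hz => hSU (mem_prod.mp hz).1)
    have h2 : ContinuousOn (fun z : K × K => unitLog z.2) (S ×ˢ S) :=
      (continuousOn_unitLog p K).comp continuous_snd.continuousOn
        (fun z hz => hSU (mem_prod.mp hz).2)
    exact ((h1.sub h2).norm).mono (fun z hz => hz.1)
  by_cases hDne : {z : K × K | z ∈ S ×ˢ S ∧ (p : ℝ) ^ (-(2 : ℝ)) ≤ ‖z.1 - z.2‖}.Nonempty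
  · obtain ⟨z₀, hz₀D, hz₀min⟩ := hDc.exists_isMinOn hDne hcont
    have hz₀S : z₀.1 ∈ S ∧ z₀.2 ∈ S := mem_prod.mp hz₀D.1
    have hne : z₀.1 ≠ z₀.2 := by
      intro h
      have h0 : (p : ℝ) ^ (-(2 : ℝ)) ≤ 0 := by simpa [h] using hz₀D.2
      exact absurd h0 (not_le.mpr (rpow_neg_two_pos p))
    have hfpos : 0 < ‖unitLog z₀.1 - unitLog z₀.2‖ :=
      norm_pos_iff.mpr (sub_ne_zero.mpr fun h => hne (hinj hz₀S.1 hz₀S.2 h))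
    refine ⟨‖unitLog z₀.1 - unitLog z₀.2‖, hfpos, fun s hs t ht hst => ?_⟩
    exact (isMinOn_iff.mp hz₀min) (s, t) ⟨mk_mem_prod hs ht, hst⟩
  · refine ⟨1, one_pos, fun s hs t ht hst => ?_⟩
    exact absurd ⟨(s, t), ⟨mk_mem_prod hs ht, hst⟩⟩ hDne

/-- **Injectivity survives a small closed thickening**: for a compact `S ⊆ 𝒪_K^×` on which `log_p`
is injective there is `ρ₁ > 0`, `ρ₁ ≤ p⁻²`, with `log_p` injective on `⋃_{s∈S} closedBall s ρ₁`
(`= cthickening ρ₁ S`). [cite: Mochizuki2012, III Rmk 3.9.4 (iii) p.122] -/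
theorem exists_injOn_cthickening {S : Set K} (hSU : S ⊆ {x : K | ‖x‖ = 1}) (hS : IsCompact S)
    (hinj : InjOn (unitLog (K := K)) S) :
    ∃ ρ₁ : ℝ, 0 < ρ₁ ∧ ρ₁ ≤ (p : ℝ) ^ (-(2 : ℝ)) ∧ InjOn (unitLog (K := K)) (cthickening ρ₁ S) := by
  obtain ⟨m, hm, hgap⟩ := exists_gap_of_injOn p K hSU hS hinj
  have hr₁0 : (0 : ℝ) < (p : ℝ) ^ (-(2 : ℝ)) := rpow_neg_two_pos p
  refine ⟨min ((p : ℝ) ^ (-(2 : ℝ))) (m / 2), lt_min hr₁0 (half_pos hm), min_le_left _ _, ?_⟩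
  have hρ0 : 0 ≤ min ((p : ℝ) ^ (-(2 : ℝ))) (m / 2) := (lt_min hr₁0 (half_pos hm)).le
  have hρr : min ((p : ℝ) ^ (-(2 : ℝ))) (m / 2) ≤ (p : ℝ) ^ (-(2 : ℝ)) := min_le_left _ _
  have hρm : min ((p : ℝ) ^ (-(2 : ℝ))) (m / 2) < m := (min_le_right _ _).trans_lt (half_lt_self hm)
  intro u hu v hv huv
  rw [hS.cthickening_eq_biUnion_closedBall hρ0] at hu hv
  obtain ⟨s, hs, hus⟩ := mem_iUnion₂.mp hu
  obtain ⟨t, ht, hvt⟩ := mem_iUnion₂.mp hv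
  have hs1 : ‖s‖ = 1 := hSU hs
  have ht1 : ‖t‖ = 1 := hSU ht
  rw [mem_closedBall_iff_norm] at hus hvt
  -- `log_p` moves `u`, `v` by at most `ρ` from `log_p s`, `log_p t`
  have hus' : ‖u - s‖ ≤ (p : ℝ) ^ (-(2 : ℝ)) := hus.trans hρr
  have hvt' : ‖v - t‖ ≤ (p : ℝ) ^ (-(2 : ℝ)) := hvt.trans hρr
  have h1 : ‖unitLog s - unitLog u‖ ≤ min ((p : ℝ) ^ (-(2 : ℝ))) (m / 2) := by
    rw [norm_sub_rev]; exact (norm_unitLog_sub_le p K hs1 hus').trans hus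
  have h2 : ‖unitLog v - unitLog t‖ ≤ min ((p : ℝ) ^ (-(2 : ℝ))) (m / 2) :=
    (norm_unitLog_sub_le p K ht1 hvt').trans hvt
  have hst : ‖unitLog s - unitLog t‖ ≤ min ((p : ℝ) ^ (-(2 : ℝ))) (m / 2) := by
    have h3 : unitLog s - unitLog t = (unitLog v - unitLog t) + (unitLog s - unitLog u) := by
      rw [huv]; abel
    rw [h3]
    exact (IsUltrametricDist.norm_add_le_max _ _).trans (max_le h2 h1)
  -- hence `s`, `t` are close, and everything happens in one ball of radius `p⁻²` around `s`
  have hst' : ‖s - t‖ < (p : ℝ) ^ (-(2 : ℝ)) := by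
    by_contra hcon
    exact absurd ((hgap s hs t ht (not_lt.mp hcon)).trans hst) (not_le.mpr hρm)
  have huB : u ∈ closedBall s ((p : ℝ) ^ (-(2 : ℝ))) := mem_closedBall_iff_norm.mpr hus'
  have hvB : v ∈ closedBall s ((p : ℝ) ^ (-(2 : ℝ))) := by
    rw [mem_closedBall_iff_norm]
    have h3 : v - s = (v - t) + (t - s) := by abel
    rw [h3]
    refine (IsUltrametricDist.norm_add_le_max _ _).trans (max_le hvt' ?_)
    rw [norm_sub_rev]; exact hst'.le
  exact unitLog_injOn_closedBall_unit p K hs1 huB hvB huv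

/-! ## 3. Thickenings: compact open, inside the units, and their images under `log_p` -/

omit instK in
/-- A closed `ρ`-thickening (`ρ > 0`) of a nonempty compact set is a (nonempty) compact open subset of
the ultrametric proper `K`. [cite: Mochizuki2012, III Rmk 3.9.4 (iii) p.122] -/
theorem cthickening_mem_compactOpens {S : Set K} (hS : IsCompact S) (hne : S.Nonempty) {ρ : ℝ}
    (hρ : 0 < ρ) : cthickening ρ S ∈ compactOpens K := by
  refine ⟨hne.mono (self_subset_cthickening S), ?_, ?_⟩
  · exact isCompact_of_isClosed_isBounded isClosed_cthickening hS.isBounded.cthickening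
  · rw [hS.cthickening_eq_biUnion_closedBall hρ.le]
    exact isOpen_biUnion fun x _ => IsUltrametricDist.isOpen_closedBall x hρ.ne'

omit instK [ProperSpace K] in
/-- A closed `ρ`-thickening, `ρ < 1`, of a compact set of units consists of units.
[cite: Mochizuki2012, III Rmk 3.9.4 (iii) p.122] -/
theorem cthickening_subset_units {S : Set K} (hSU : S ⊆ {x : K | ‖x‖ = 1}) (hS : IsCompact S)
    {ρ : ℝ} (hρ0 : 0 ≤ ρ) (hρ1 : ρ < 1) : cthickening ρ S ⊆ {x : K | ‖x‖ = 1} := by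
  intro y hy
  rw [hS.cthickening_eq_biUnion_closedBall hρ0] at hy
  obtain ⟨s, hs, hys⟩ := mem_iUnion₂.mp hy
  exact norm_eq_one_of_mem_closedBall_unit (hSU hs) hρ1 hys

/-- `log_p(S)` is compact for compact `S ⊆ 𝒪_K^×` (`log_p` is continuous on the units).
[cite: Mochizuki2012, III Rmk 3.9.4 (iii) p.122] -/
theorem isCompact_image_unitLog {S : Set K} (hSU : S ⊆ {x : K | ‖x‖ = 1}) (hS : IsCompact S) :
    IsCompact (unitLog '' S) :=
  hS.image_of_continuousOn ((continuousOn_unitLog p K).mono hSU)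

/-- **`log_p` of a small thickening is the thickening of `log_p`**: if `log_p` maps every closed ball of
radius `ρ` centred at a unit onto the closed ball of radius `ρ` centred at the image, then
`log_p(cthickening ρ S) = cthickening ρ (log_p S)` for compact `S ⊆ 𝒪_K^×`.
[cite: Mochizuki2012, III Rmk 3.9.4 (iii) p.122] -/
theorem image_unitLog_cthickening {S : Set K} (hSU : S ⊆ {x : K | ‖x‖ = 1}) (hS : IsCompact S)
    {ρ : ℝ} (hρ0 : 0 ≤ ρ)
    (hiso : ∀ x : K, ‖x‖ = 1 → unitLog '' closedBall x ρ = closedBall (unitLog x) ρ) :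
    unitLog '' cthickening ρ S = cthickening ρ (unitLog '' S) := by
  rw [hS.cthickening_eq_biUnion_closedBall hρ0,
    (isCompact_image_unitLog p K hSU hS).cthickening_eq_biUnion_closedBall hρ0, image_iUnion₂,
    biUnion_image]
  exact iUnion₂_congr fun s hs => hiso s (hSU hs)

/-! ## 4. The theorem for the normalised Haar measure `localHaar K` -/

variable [MeasurableSpace K] [BorelSpace K]

/-- Prop. 5.7 (i)(c) at the level of MEASURES for compact open sets: `μ_k(log_p A) = μ_k(A)` for
`A ∈ M(k)`, `A ⊆ 𝒪_K^×`, `log_p` injective on `A`, `log_p(A) ∈ M(k)` (unwinding abc-iut-L4-t3's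
log-volume formulation). [cite: Mochizuki2012, III Rmk 3.9.4 (iii) p.122] -/
theorem localHaar_image_unitLog_of_mem_compactOpens {A : Set K} (hA : A ∈ compactOpens K)
    (hAU : A ⊆ {x : K | ‖x‖ = 1}) (hinj : InjOn (unitLog (K := K)) A)
    (himA : unitLog '' A ∈ compactOpens K) : localHaar K (unitLog '' A) = localHaar K A := by
  have hlog : localLogVolume K A = localLogVolume K (unitLog '' A) :=
    LogVolumeCompatibleOfIsometric_holds (K := K) unitLog (isIsometricOnSmallBalls_unitLog p)
      A hA hAU hinj himA
  -- `log μ(A) = log μ(log A)` with both volumes positive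
  have hvol : localVolume K (unitLog '' A) = localVolume K A := by
    unfold localLogVolume at hlog
    exact Real.log_injOn_pos (mem_Ioi.mpr (localVolume_pos himA)) (mem_Ioi.mpr (localVolume_pos hA))
      hlog.symm
  unfold localVolume at hvol
  exact (ENNReal.toReal_eq_toReal_iff' (localHaar_lt_top_of_mem himA).ne
    (localHaar_lt_top_of_mem hA).ne).mp hvol

/-- **Remark 3.9.4 (iii) for `μ_k = localHaar K`**: for every COMPACT `S ⊆ 𝒪_K^×` on which `log_p` is
injective, `μ_k(log_p S) = μ_k(S)`. [cite: Mochizuki2012, III Rmk 3.9.4 (iii) p.122] -/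
theorem localHaar_image_unitLog_eq {S : Set K} (hSU : S ⊆ {x : K | ‖x‖ = 1}) (hS : IsCompact S)
    (hinj : InjOn (unitLog (K := K)) S) : localHaar K (unitLog '' S) = localHaar K S := by
  rcases S.eq_empty_or_nonempty with rfl | hne
  · simp
  -- the two radii: isometry radius `r₀`, injectivity radius `ρ₁ ≤ p⁻² < 1`
  obtain ⟨r₀, hr₀, hiso⟩ := isIsometricOnSmallBalls_unitLog p (K := K)
  obtain ⟨ρ₁, hρ₁, hρ₁le, hinj₁⟩ := exists_injOn_cthickening p K hSU hS hinj
  have hρ₁1 : ρ₁ < 1 := hρ₁le.trans_lt (rpow_neg_two_lt_one p)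
  have hTc : IsCompact (unitLog '' S) := isCompact_image_unitLog p K hSU hS
  have hTne : (unitLog '' S).Nonempty := hne.image _
  -- for `0 < ρ ≤ min r₀ ρ₁` the thickenings have the same measure
  have key : ∀ ρ : ℝ, 0 < ρ → ρ ≤ min r₀ ρ₁ →
      localHaar K (cthickening ρ S) = localHaar K (cthickening ρ (unitLog '' S)) := by
    intro ρ hρ hρle
    have hρr₀ : ρ ≤ r₀ := hρle.trans (min_le_left _ _)
    have hρρ₁ : ρ ≤ ρ₁ := hρle.trans (min_le_right _ _)
    have himg : unitLog '' cthickening ρ S = cthickening ρ (unitLog '' S) :=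
      image_unitLog_cthickening p K hSU hS hρ.le fun x hx => hiso x hx ρ hρ hρr₀
    have himA : unitLog '' cthickening ρ S ∈ compactOpens K := by
      rw [himg]; exact cthickening_mem_compactOpens K hTc hTne hρ
    rw [← himg]
    exact (localHaar_image_unitLog_of_mem_compactOpens p K (cthickening_mem_compactOpens K hS hne hρ)
      (cthickening_subset_units K hSU hS hρ.le (hρρ₁.trans_lt hρ₁1))
      (hinj₁.mono (cthickening_mono hρρ₁ S)) himA).symm
  -- pass to the limit `ρ → 0⁺`
  have hlimS : Tendsto (fun ρ => localHaar K (cthickening ρ S)) (𝓝[>] 0) (𝓝 (localHaar K S)) :=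
    (tendsto_measure_cthickening_of_isCompact hS).mono_left nhdsWithin_le_nhds
  have hlimT : Tendsto (fun ρ => localHaar K (cthickening ρ (unitLog '' S))) (𝓝[>] 0)
      (𝓝 (localHaar K (unitLog '' S))) :=
    (tendsto_measure_cthickening_of_isCompact hTc).mono_left nhdsWithin_le_nhds
  have heq : (fun ρ => localHaar K (cthickening ρ S)) =ᶠ[𝓝[>] 0]
      fun ρ => localHaar K (cthickening ρ (unitLog '' S)) := by
    filter_upwards [Ioo_mem_nhdsGT (lt_min hr₀ hρ₁)] with ρ hρ
    exact key ρ hρ.1 hρ.2.le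
  exact (tendsto_nhds_unique (hlimS.congr' heq) hlimT).symm

/-! ## 5. Any additive Haar measure; the named fact -/

/-- **Remark 3.9.4 (iii) for an arbitrary additive Haar measure `μ` of `K`** (a scalar multiple of
`μ_k`): `μ(log_p S) = μ(S)` for every compact `S ⊆ 𝒪_K^×` on which `log_p` is injective.
[cite: Mochizuki2012, III Rmk 3.9.4 (iii) p.122] -/
theorem measure_image_unitLog_eq (μ : Measure K) [IsAddHaarMeasure μ] {S : Set K}
    (hSU : S ⊆ {x : K | ‖x‖ = 1}) (hS : IsCompact S) (hinj : InjOn (unitLog (K := K)) S) :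
    μ (unitLog '' S) = μ S := by
  have hμ : μ = μ (integersPositiveCompacts K) • localHaar K :=
    addHaarMeasure_unique μ (integersPositiveCompacts K)
  rw [hμ, Measure.smul_apply, Measure.smul_apply, smul_eq_mul, smul_eq_mul,
    localHaar_image_unitLog_eq p K hSU hS hinj]

/-- **IUTchIII:Rmk3.9.4(iii)** (kurims p.122 l.62) DISCHARGED at the real objects: abc-iut-L6-t4's named
fact `Remark394iii_logPreservesVolume U logk vol` holds for `U = 𝒪_K^× = {‖x‖ = 1}`,
`logk = log_p` (`Literature.IUT.LogVolume.unitLog`) and `vol = μ` any additive Haar measure on a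
mixed-characteristic nonarchimedean local field `K` — "for any compact ample subset `S ⊆ 𝒪^×_k` on which
`log_k` is injective, we have `μ_k(S) = μ_k(log_k(S))`" (the positivity hypothesis is not needed).
[cite: Mochizuki2012, III Rmk 3.9.4 (iii) p.122] -/
theorem remark394iii_logPreservesVolume_unitLog (μ : Measure K) [IsAddHaarMeasure μ] :
    Remark394iii_logPreservesVolume {x : K | ‖x‖ = 1} (unitLog (K := K)) μ :=
  fun _S hSU hS _ hinj => measure_image_unitLog_eq p K μ hSU hS hinj

/-- The same for abc-iut-L4-t3's normalised measure `μ_k = localHaar K` (`μ_k(𝒪_k) = 1`, the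
normalisation printed in Remark 3.9.4 (iii): "`μ_k(𝒪_k) = 1`").
[cite: Mochizuki2012, III Rmk 3.9.4 (iii) p.122] -/
theorem remark394iii_logPreservesVolume_localHaar :
    Remark394iii_logPreservesVolume {x : K | ‖x‖ = 1} (unitLog (K := K)) (localHaar K) :=
  remark394iii_logPreservesVolume_unitLog p K (localHaar K)

end Literature.IUT.LogThetaLattice

end
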